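import Summits.ResolutionOfSingularities.ResolutionOfSingularities.Theses.IndSmooth
import Literature.RingTheory.Localization.DerivationFractionField

/-!
# `ValuativeSmoothing` — negative lemmas II: the derivation mechanism (all primes), `R.FG` is
# load-bearing, necessity of `R ≤ O`, non-vacuity

Support (negative) lemmas for crux `stmt-ResolutionOfSingularities-16087`
(`Summit.ResolutionOfSingularities.ResolutionOfSingularities.Theses.IndSmooth.ValuativeSmoothing`:
for every prime `p`, every PERFECT field `k` of characteristic `p`, every finitely generated field
extension `K/k`, every valuation ring `O ⊇ k` of `K` and every finitely generated `k`-subalgebra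
`R ⊆ O`, the inclusion `R ↪ O` factors `R →ψ T →χ O` through a SMOOTH `k`-algebra `T` — "valuation
rings of function fields over perfect fields are ind-smooth"), filed by the standing disprover
(cdisprove gen 1, cycle 1; work file `Cruxes/ValuativeSmoothing/Disproof.lean` carries the full
analysis and verdict). Companion of `FalseWithoutPerfectField.lean` (vetting seat, p146418: the
`p = 2` specimen via "retract of smooth ⇒ formally smooth ⇒ separable"). This file declares NO
definition: every variant statement is written out inline, and NO declaration concludes the route
decl `ValuativeSmoothing` positively.

* `false_of_pow_char_eq_algebraMap` — a second, retraction-free MECHANISM: if `D` is a derivation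
  of a field `k` of characteristic `p` and `a ∈ k` has `D a ≠ 0`, then NO non-zero formally smooth
  `k`-algebra `T` contains `b` with `b ^ p = a` (lift `id_T` through the square-zero extension
  `T[ε] ↠ T` whose `k`-structure is twisted to `c ↦ c + D(c)ε`: the lift `σ` has
  `σ(a) = a + D(a)ε`, but `σ(a) = σ(b)^p` has `ε`-part `p·b^{p-1}·(…) = 0`). It needs neither
  `χ ∘ ψ = incl` nor algebraicity of `K/k`: over an imperfect `k`, no valuation ring containing a
  `p`-th root of a `D`-moved constant receives even a single map `R → T ≠ 0` with `T` smooth.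
* `valuativeSmoothing_without_perfectField_fails_at` — with `[PerfectField k]` DROPPED the crux
  fails AT EVERY PRIME `p` (not only `p = 2`): `k = 𝔽_p(x)`, `K = k(x^{1/p})`, trivial valuation
  `O = K`, `R = K = k[x^{1/p}]`, `D = d/dx` (the tree's `Derivation.fractionFieldExtend`);
  `valuativeSmoothing_iff_perfect_restated` (`Iff.rfl`) records that exactly one hypothesis was
  mutated.
* `valuativeSmoothing_false_without_fg` — with `R.FG` DROPPED the crux is FALSE: `k = 𝔽₂`,
  `K = O = R = 𝔽₂(x)`; a factorisation of `id_K` through a smooth `T` makes the field `K` a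
  quotient of a finite-type `k`-algebra, hence algebraic over `k` (Zariski's lemma, Mathlib's
  `MvPolynomial.comp_C_integral_of_surjective_of_isJacobsonRing`;
  `not_surjective_ratFunc_of_finiteType`), but `x` is transcendental. So `O` is never itself a
  retract of ONE smooth algebra (unless `K/k` is algebraic): the statement is irreducibly "ind",
  and a line's smoothing step must produce `T` depending on `R`.
* `valuativeSmoothing_le_of_factor` — the conclusion FORCES `R ≤ O` (the hypothesis `hRO` cannot
  be weakened; `k ⊆ O` is redundant, see `algebraMap_mem_of_subalgebra_le` in the companion file);
  `valuativeSmoothing_hypotheses_satisfiable` — NON-VACUITY in Lean (`p = 2`, `k = K = 𝔽₂`,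
  `O = K`, `R = k`), together with the conclusion there (`T = k`).

## Sources
* B. Antieau, R. Datta, *Valuation rings are derived splinters*, Math. Z. 299 (2021), §4 Prop. 27
  (ind-smoothness known for PERFECT valuation rings only). [AntieauDatta2021]
* N. Bourbaki, *Algebra II*, Ch. V §16 (derivations kill `p`-th powers; extension to fraction
  fields). [folklore]
* The Stacks Project, Tag 00TH (formal smoothness: infinitesimal lifting), Tag 00FZ (Zariski's
  lemma). [StacksProject]
-/
noncomputable section

open Polynomial
open Summit.ResolutionOfSingularities.ResolutionOfSingularities.Theses.IndSmooth

set_option linter.dupNamespace false -- mandated namespace of this single-conjunct summit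

namespace Summit.ResolutionOfSingularities.ResolutionOfSingularities.Theorems.ValuativeSmoothing.Negative

/-! ### The mechanism -/

/-- **No formally smooth `k`-algebra contains a `p`-th root of an element of `k` moved by a
derivation.** If `D` is a derivation of the field `k` of characteristic `p`, `a ∈ k` has
`D a ≠ 0`, and `T ≠ 0` is formally smooth over `k`, then no `b ∈ T` satisfies `b ^ p = a`.
Proof: give the dual numbers `T[ε]` the `k`-algebra structure `c ↦ c + D(c)ε` (a ring map because
`D` is a derivation); the first projection `T[ε] ↠ T` is a `k`-algebra surjection with square-zero
kernel, so formal smoothness lifts `id_T` to `σ : T → T[ε]`; then `σ(a) = a + D(a)ε` while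
`σ(a) = σ(b^p) = σ(b)^p` has `ε`-component `p · b^{p-1} · (…) = 0`; hence `D(a) = 0` in `T ⊇ k`.
[folklore] -/
theorem false_of_pow_char_eq_algebraMap {S k : Type*} [CommRing S] [Field k] [Algebra S k]
    (D : Derivation S k k) (p : ℕ) [CharP k p] {T : Type*} [CommRing T] [Algebra k T]
    [Algebra.FormallySmooth k T] [Nontrivial T] (a : k) (ha : D a ≠ 0) (b : T)
    (hb : b ^ p = algebraMap k T a) : False := by
  -- the twisted structure map `c ↦ (c, D c)`
  let φ : k →+* TrivSqZeroExt T T :=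
    { toFun := fun c => (algebraMap k T c, algebraMap k T (D c))
      map_one' := by
        refine TrivSqZeroExt.ext ?_ ?_
        · simp
        · simp [Derivation.map_one_eq_zero]
      map_mul' := fun a b => by
        refine TrivSqZeroExt.ext ?_ ?_
        · simp
        · change algebraMap k T (D (a * b)) = algebraMap k T a • algebraMap k T (D b) +
            MulOpposite.op (algebraMap k T b) • algebraMap k T (D a)
          rw [D.leibniz]
          simp only [MulOpposite.smul_eq_mul_unop, MulOpposite.unop_op, smul_eq_mul, map_add,
            map_mul]
          ring
      map_zero' := by refine TrivSqZeroExt.ext ?_ ?_ <;> simp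
      map_add' := fun a b => by refine TrivSqZeroExt.ext ?_ ?_ <;> simp }
  have hφ_fst : ∀ c, (φ c).fst = algebraMap k T c := fun _ => rfl
  have hφ_snd : ∀ c, (φ c).snd = algebraMap k T (D c) := fun _ => rfl
  -- `T[ε]` as a `k`-algebra through `φ` (local instance, shadowing the untwisted one)
  letI alg : Algebra k (TrivSqZeroExt T T) := φ.toAlgebra
  let π : TrivSqZeroExt T T →ₐ[k] T :=
    { toFun := fun x => x.fst
      map_one' := TrivSqZeroExt.fst_one
      map_mul' := fun x y => TrivSqZeroExt.fst_mul x y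
      map_zero' := TrivSqZeroExt.fst_zero
      map_add' := fun x y => TrivSqZeroExt.fst_add x y
      commutes' := fun _ => rfl }
  have hπ : Function.Surjective π := fun t => ⟨TrivSqZeroExt.inl t, rfl⟩
  have hker2 : RingHom.ker (π : TrivSqZeroExt T T →+* T) ^ 2 = ⊥ := by
    rw [pow_two, eq_bot_iff, Ideal.mul_le]
    intro x hx y hy
    rw [RingHom.mem_ker] at hx hy
    change x.fst = 0 at hx
    change y.fst = 0 at hy
    rw [Ideal.mem_bot]
    refine TrivSqZeroExt.ext ?_ ?_
    · rw [TrivSqZeroExt.fst_mul, hx, zero_mul, TrivSqZeroExt.fst_zero]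
    · rw [TrivSqZeroExt.snd_mul, hx, hy, zero_smul, MulOpposite.op_zero, zero_smul, add_zero,
        TrivSqZeroExt.snd_zero]
  have hker : IsNilpotent (RingHom.ker (π : TrivSqZeroExt T T →+* T)) := ⟨2, by rw [hker2]; rfl⟩
  -- the lift
  let σ : T →ₐ[k] TrivSqZeroExt T T := Algebra.FormallySmooth.liftOfSurjective (AlgHom.id k T) π hπ hker
  haveI : CharP T p := charP_of_injective_algebraMap (algebraMap k T).injective p
  have h1 : (σ (algebraMap k T a)).snd = algebraMap k T (D a) := by
    rw [σ.commutes]; exact hφ_snd a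
  have h2 : (σ (algebraMap k T a)).snd = 0 := by
    rw [← hb, map_pow, TrivSqZeroExt.snd_pow_of_smul_comm _ _ (by
      rw [MulOpposite.smul_eq_mul_unop, MulOpposite.unop_op, smul_eq_mul, mul_comm]), nsmul_eq_mul,
      CharP.cast_eq_zero, zero_mul]
  exact ha ((algebraMap k T).injective (by rw [map_zero, ← h2, h1]))

/-! ### `[PerfectField k]` is load-bearing -/

/-- With `[PerfectField k]` dropped, the crux FAILS AT EVERY PRIME `p`: `k = 𝔽_p(x)`,
`K = k[Y]/(Y^p - x) = 𝔽_p(x^{1/p})`, `O = K` (trivial valuation), `R = K = k[x^{1/p}]`; any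
`ψ : R → T` into a smooth `T ≠ 0` would put a `p`-th root of `x` in `T`, but `d/dx (x) = 1 ≠ 0`
(`false_of_pow_char_eq_algebraMap`). Note that `χ ∘ ψ = incl` is not even used, only `T ≠ 0`.
[folklore] -/
theorem valuativeSmoothing_without_perfectField_fails_at (p : ℕ) (hp : p.Prime) :
    ¬ ∀ (k K : Type) [Field k] [CharP k p] [Field K] [Algebra k K],
      (⊤ : IntermediateField k K).FG → ∀ O : ValuationSubring K, (∀ c : k, algebraMap k K c ∈ O) →
        ∀ R : Subalgebra k K, R.FG → R.toSubring ≤ O.toSubring →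
          ∃ (T : Type) (_ : CommRing T) (_ : Algebra k T), Algebra.Smooth k T ∧
            ∃ (ψ : R →ₐ[k] T) (χ : T →ₐ[k] K), (∀ t : T, χ t ∈ O) ∧ ∀ r : R, χ (ψ r) = (r : K) := by
  haveI : Fact p.Prime := ⟨hp⟩
  intro h
  -- `d/dx` on `𝔽_p(x)`
  let ddx : Derivation (ZMod p) (RatFunc (ZMod p)) (RatFunc (ZMod p)) :=
    (mkDerivation (ZMod p) (1 : RatFunc (ZMod p))).fractionFieldExtend (F := RatFunc (ZMod p))
  have hddx : ddx RatFunc.X = 1 := by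
    change ((mkDerivation (ZMod p) (1 : RatFunc (ZMod p))).fractionFieldExtend
      (F := RatFunc (ZMod p))) RatFunc.X = 1
    rw [← RatFunc.algebraMap_X, Derivation.fractionFieldExtend_algebraMap, mkDerivation_X]
  -- `x` is not a `p`-th power, so `Y^p - x` is irreducible and `K` is a field
  have hx : ∀ b : RatFunc (ZMod p), b ^ p ≠ RatFunc.X := by
    intro b hb
    have h1 : ddx (b ^ p) = 0 := by
      rw [Derivation.leibniz_pow, nsmul_eq_mul, CharP.cast_eq_zero, zero_mul]
    rw [hb, hddx] at h1
    exact one_ne_zero h1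
  haveI : Fact (Irreducible (X ^ p - C RatFunc.X : (RatFunc (ZMod p))[X])) :=
    ⟨X_pow_sub_C_irreducible_of_prime hp hx⟩
  have hroot : (AdjoinRoot.root (X ^ p - C RatFunc.X : (RatFunc (ZMod p))[X])) ^ p =
      algebraMap (RatFunc (ZMod p)) _ RatFunc.X := by
    have h := AdjoinRoot.aeval_eq (f := (X ^ p - C RatFunc.X : (RatFunc (ZMod p))[X])) (X ^ p - C RatFunc.X)
    rw [AdjoinRoot.mk_self, map_sub, map_pow, aeval_X, aeval_C, sub_eq_zero] at h
    exact h
  have htop : Algebra.adjoin (RatFunc (ZMod p))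
      {AdjoinRoot.root (X ^ p - C RatFunc.X : (RatFunc (ZMod p))[X])} = ⊤ :=
    AdjoinRoot.adjoinRoot_eq_top
  have hKfg : (⊤ : IntermediateField (RatFunc (ZMod p))
      (AdjoinRoot (X ^ p - C RatFunc.X : (RatFunc (ZMod p))[X]))).FG := by
    have h' : IntermediateField.adjoin (RatFunc (ZMod p))
        {AdjoinRoot.root (X ^ p - C RatFunc.X : (RatFunc (ZMod p))[X])} = ⊤ := by
      rw [eq_top_iff]
      intro x _
      exact IntermediateField.algebra_adjoin_le_adjoin _ _ (by rw [htop]; exact Algebra.mem_top)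
    rw [← h']
    exact IntermediateField.fg_adjoin_of_finite (Set.finite_singleton _)
  have hRfg : (⊤ : Subalgebra (RatFunc (ZMod p))
      (AdjoinRoot (X ^ p - C RatFunc.X : (RatFunc (ZMod p))[X]))).FG :=
    ⟨{AdjoinRoot.root _}, by rw [Finset.coe_singleton]; exact htop⟩
  obtain ⟨T, _, _, hT, ψ, χ, -, -⟩ := h (RatFunc (ZMod p)) (AdjoinRoot (X ^ p - C RatFunc.X))
    hKfg ⊤ (fun _ => ValuationSubring.mem_top _) ⊤ hRfg (fun x _ => ValuationSubring.mem_top x)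
  haveI : Algebra.Smooth (RatFunc (ZMod p)) T := hT
  haveI : Nontrivial T := χ.toRingHom.domain_nontrivial
  set r : (⊤ : Subalgebra (RatFunc (ZMod p)) (AdjoinRoot (X ^ p - C RatFunc.X : (RatFunc (ZMod p))[X]))) :=
    ⟨AdjoinRoot.root _, Algebra.mem_top⟩
  have hr : r ^ p = algebraMap (RatFunc (ZMod p)) _ RatFunc.X :=
    Subtype.ext (by rw [SubmonoidClass.coe_pow, Subalgebra.coe_algebraMap]; exact hroot)
  have hb : (ψ r) ^ p = algebraMap (RatFunc (ZMod p)) T RatFunc.X := by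
    rw [← map_pow, hr, AlgHom.commutes]
  exact false_of_pow_char_eq_algebraMap ddx p RatFunc.X (by rw [hddx]; exact one_ne_zero) (ψ r) hb

/-- The crux is `Iff.rfl`-equal to the dropped-hypothesis statement with `[PerfectField k]`
reinstated: `valuativeSmoothing_without_perfectField_fails_at` (and the companion file's
`valuativeSmoothing_false_without_perfectField`) mutate exactly one hypothesis. -/
theorem valuativeSmoothing_iff_perfect_restated :
    ValuativeSmoothing ↔ ∀ p : ℕ, p.Prime → ∀ (k K : Type) [Field k] [CharP k p] [PerfectField k]
      [Field K] [Algebra k K],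
      (⊤ : IntermediateField k K).FG → ∀ O : ValuationSubring K, (∀ c : k, algebraMap k K c ∈ O) →
        ∀ R : Subalgebra k K, R.FG → R.toSubring ≤ O.toSubring →
          ∃ (T : Type) (_ : CommRing T) (_ : Algebra k T), Algebra.Smooth k T ∧
            ∃ (ψ : R →ₐ[k] T) (χ : T →ₐ[k] K), (∀ t : T, χ t ∈ O) ∧ ∀ r : R, χ (ψ r) = (r : K) :=
  Iff.rfl

/-! ### `R.FG` is load-bearing -/

/-- A field receiving a SURJECTION from a finite-type `k`-algebra is algebraic over `k` (Zariski's
lemma), so `𝔽_q(x)` is not a quotient of one (`x` is transcendental). [folklore] -/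
theorem not_surjective_ratFunc_of_finiteType (k : Type) [Field k] {T : Type} [CommRing T]
    [Algebra k T] [Algebra.FiniteType k T] (χ : T →ₐ[k] RatFunc k) : ¬ Function.Surjective χ := by
  intro hχ
  obtain ⟨n, f, hf⟩ := Algebra.FiniteType.iff_quotient_mvPolynomial''.1 ‹Algebra.FiniteType k T›
  have hsurj : Function.Surjective ((χ.comp f : MvPolynomial (Fin n) k →+* RatFunc k)) :=
    hχ.comp hf
  have hint := MvPolynomial.comp_C_integral_of_surjective_of_isJacobsonRing _ hsurj
  have heq : ((χ.comp f : MvPolynomial (Fin n) k →+* RatFunc k)).comp MvPolynomial.C =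
      algebraMap k (RatFunc k) := by
    rw [← MvPolynomial.algebraMap_eq]
    exact (χ.comp f).comp_algebraMap
  rw [heq] at hint
  have hX : IsIntegral k (RatFunc.X : RatFunc k) := hint RatFunc.X
  have htr : Transcendental k (RatFunc.X : RatFunc k) := by
    rw [← RatFunc.algebraMap_X,
      transcendental_algebraMap_iff (IsFractionRing.injective k[X] (RatFunc k))]
    exact transcendental_X k
  exact htr hX.isAlgebraic

/-- **`R.FG` is load-bearing for `ValuativeSmoothing`**: the crux with `R.FG` DROPPED
(everything else verbatim) is false — `p = 2`, `k = 𝔽₂`, `K = O = R = 𝔽₂(x)`: a factorisation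
`K →ψ T →χ K` of the identity through a smooth (hence finite-type) `T` makes `χ` surjective.
[folklore] -/
theorem valuativeSmoothing_false_without_fg :
    ¬ ∀ p : ℕ, p.Prime → ∀ (k K : Type) [Field k] [CharP k p] [PerfectField k] [Field K]
      [Algebra k K], (⊤ : IntermediateField k K).FG → ∀ O : ValuationSubring K,
        (∀ c : k, algebraMap k K c ∈ O) → ∀ R : Subalgebra k K, R.toSubring ≤ O.toSubring →
          ∃ (T : Type) (_ : CommRing T) (_ : Algebra k T), Algebra.Smooth k T ∧
            ∃ (ψ : R →ₐ[k] T) (χ : T →ₐ[k] K), (∀ t : T, χ t ∈ O) ∧ ∀ r : R, χ (ψ r) = (r : K) := by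
  intro h
  have hfg : (⊤ : IntermediateField (ZMod 2) (RatFunc (ZMod 2))).FG := by
    rw [IntermediateField.fg_top_iff]
    haveI : Algebra.EssFiniteType (ZMod 2)[X] (RatFunc (ZMod 2)) :=
      Algebra.EssFiniteType.of_isLocalization (RatFunc (ZMod 2)) (nonZeroDivisors (ZMod 2)[X])
    exact Algebra.EssFiniteType.comp (ZMod 2) (ZMod 2)[X] (RatFunc (ZMod 2))
  obtain ⟨T, _, _, hT, ψ, χ, -, hψχ⟩ := h 2 Nat.prime_two (ZMod 2) (RatFunc (ZMod 2)) hfg ⊤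
    (fun _ => ValuationSubring.mem_top _) ⊤ (fun x _ => ValuationSubring.mem_top x)
  haveI : Algebra.Smooth (ZMod 2) T := hT
  exact not_surjective_ratFunc_of_finiteType (ZMod 2) χ fun x =>
    ⟨ψ ⟨x, Algebra.mem_top⟩, hψχ ⟨x, Algebra.mem_top⟩⟩

/-! ### Redundancy, necessity, non-vacuity -/

/-- The conclusion of the crux FORCES `R ≤ O` (`r = χ (ψ r) ∈ χ(T) ⊆ O`): `hRO` cannot be
weakened (whereas `k ⊆ O` is redundant: `algebraMap_mem_of_subalgebra_le` of the companion file).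
[folklore] -/
theorem valuativeSmoothing_le_of_factor {k K : Type} [Field k] [Field K] [Algebra k K]
    (O : ValuationSubring K) (R : Subalgebra k K) {T : Type} [CommRing T] [Algebra k T]
    (ψ : R →ₐ[k] T) (χ : T →ₐ[k] K) (hχ : ∀ t : T, χ t ∈ O) (hψχ : ∀ r : R, χ (ψ r) = (r : K)) :
    R.toSubring ≤ O.toSubring := by
  intro x hx
  have := hχ (ψ ⟨x, hx⟩)
  rwa [hψχ] at this

/-- NON-VACUITY: the hypotheses of the crux are simultaneously satisfiable (`p = 2`,
`k = K = 𝔽₂`, `O = K`, `R = k`), and in that instance the conclusion holds with `T = k`. -/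
theorem valuativeSmoothing_hypotheses_satisfiable :
    ∃ (p : ℕ) (_ : p.Prime) (k K : Type) (_ : Field k) (_ : CharP k p) (_ : PerfectField k)
      (_ : Field K) (_ : Algebra k K), (⊤ : IntermediateField k K).FG ∧
        ∃ O : ValuationSubring K, (∀ c : k, algebraMap k K c ∈ O) ∧
          ∃ R : Subalgebra k K, R.FG ∧ R.toSubring ≤ O.toSubring ∧
            ∃ (T : Type) (_ : CommRing T) (_ : Algebra k T), Algebra.Smooth k T ∧
              ∃ (ψ : R →ₐ[k] T) (χ : T →ₐ[k] K), (∀ t : T, χ t ∈ O) ∧ ∀ r : R, χ (ψ r) = (r : K) :=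
  ⟨2, Nat.prime_two, ZMod 2, ZMod 2, inferInstance, inferInstance, inferInstance, inferInstance,
    inferInstance, IntermediateField.fg_of_noetherian ⊤, ⊤, fun _ => ValuationSubring.mem_top _, ⊥,
    Subalgebra.fg_bot, fun x _ => ValuationSubring.mem_top x, ZMod 2, inferInstance, inferInstance,
    inferInstance, (⊥ : Subalgebra (ZMod 2) (ZMod 2)).val, AlgHom.id _ _,
    fun t => ValuationSubring.mem_top t, fun _ => rfl⟩

end Summit.ResolutionOfSingularities.ResolutionOfSingularities.Theorems.ValuativeSmoothing.Negative
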